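import Summits.CriticalPhenomena.PercolationContinuityZ3.Theorems.PercExchangeRateTransportCriticalCurveRegular
import Summits.CriticalPhenomena.PercolationContinuityZ3.Theorems.PercExchangeRateTransportModelFacts

/-!
# Line `iso_left_min` — ON-PATH lemma (F4), stand-alone copy

`PercolationContinuityZ3 → IsoLeftMin`: the summit statement implies the generation-7 rung of the forward ladder over
`CriticalCurveRegular` (crux K⁺ `SupercritExchangeUniformity`, item stmt-CriticalPhenomena-16061, route
`PercExchangeRateTransport`).  Self-contained: imports only the floor theorem file and `ModelFacts`; the definitions
`CurveLeftMinWithin` / `IsoLeftMin` are verbatim copies of the ones in `Lines/iso_left_min.lean` (namespace `…LeftMin`),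
placed here in `…LeftMin.OnPath` so that both files build independently.  PROVED, no `sorry`:
continuity of `p_c` at `p₃ = p_c(ℤ³)` (the floor) and `p_c(t) ≤ t` for `p₃ < t < 1` (`ModelFacts` (9): the diagonal is
isotropic bond percolation on `ℤ³`, `θ_{ℤ³} > 0` above `p_c`) give `p_c(p₃) ≤ p₃`, hence
`J(p₃) = θ(p_c(p₃),p₃) ≤ θ(p₃,p₃) = θ_{ℤ³}(p_c(ℤ³)) = 0 ≤ J(s)` under the statement.
-/

namespace Summit.CriticalPhenomena.PercolationContinuityZ3.Cruxes.SupercritExchangeUniformity.LeftMin.OnPath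

open Summit.CriticalPhenomena.PercolationContinuityZ3.Theses.PercExchangeRateTransport

/-- FAMILY. The route's verbatim `let`-objects `μ, vert, cfg, θ, pc`; the floor `CriticalCurveRegular` AND, at every
level `t₀ ∈ T ∩ (0,1)`, the left-local-minimum clause: `∃ lo ∈ (0,t₀)`, `J(t₀) ≤ J(s)` for all `s ∈ [lo,t₀]`
(`J(t) = θ (pc t) t`). -/
def CurveLeftMinWithin (T : Set ℝ) : Prop :=
  let μ := Literature.Probability.Percolation.labelMeasure (Literature.Probability.LatticeModels.Site 3); let vert : Sym2 (Literature.Probability.LatticeModels.Site 3) → Prop := fun e => ∃ x : Literature.Probability.LatticeModels.Site 3, e = s(x, x + Pi.single (2 : Fin 3) 1); let cfg : ℝ → ℝ → (Sym2 (Literature.Probability.LatticeModels.Site 3) → ℝ) → Set (Sym2 (Literature.Probability.LatticeModels.Site 3)) := fun p t U => {e | e ∈ (Literature.Probability.LatticeModels.zdGraph 3).edgeSet ∧ ((vert e ∧ U e ≤ t) ∨ (¬ vert e ∧ U e ≤ p))}; let θ : ℝ → ℝ → ℝ := fun p t => μ.real {U | cfg p t U ∈ Literature.Probability.Percolation.percolatesAt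 (0 : Literature.Probability.LatticeModels.Site 3)}; let pc : ℝ → ℝ := fun t => sInf ({p : ℝ | 0 ≤ p ∧ p ≤ 1 ∧ 0 < θ p t} ∪ {1}); (ContinuousOn pc (Set.Ioo 0 1) ∧ ∀ t ∈ Set.Ioo (0 : ℝ) 1, 0 < pc t ∧ pc t < 1) ∧ ∀ t₀ ∈ T, t₀ ∈ Set.Ioo (0 : ℝ) 1 → ∃ lo : ℝ, 0 < lo ∧ lo < t₀ ∧ ∀ s ∈ Set.Icc lo t₀, θ (pc t₀) t₀ ≤ θ (pc s) s

/-- RUNG. The isotropic level `p₃ = p_c(ℤ³)` is a left local minimum of the critical density along the curve: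
the family at `T = {p₃}`. -/
def IsoLeftMin : Prop := CurveLeftMinWithin {Literature.Probability.Percolation.criticalProb (Literature.Probability.LatticeModels.zdGraph 3) (0 : Literature.Probability.LatticeModels.Site 3)}

/-- The family is antitone in the parameter `T`. -/
theorem curveLeftMinWithin_mono {T T' : Set ℝ} (h : T ⊆ T') : CurveLeftMinWithin T' → CurveLeftMinWithin T := by
  unfold CurveLeftMinWithin
  intro h'
  exact ⟨h'.1, fun t ht => h'.2 t (h ht)⟩

/-- The `T = ∅` member is the floor (proved from the seed). -/
theorem curveLeftMinWithin_empty : CurveLeftMinWithin ∅ := by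
  unfold CurveLeftMinWithin
  exact ⟨Summit.CriticalPhenomena.PercolationContinuityZ3.Cruxes.CriticalCurveRegular.Locmod.CriticalCurveRegular_proof,
    fun t ht _ => (Set.notMem_empty t ht).elim⟩

/-- … and it is literally the floor (both directions). -/
theorem curveLeftMinWithin_empty_iff : CurveLeftMinWithin ∅ ↔ CriticalCurveRegular := by
  unfold CurveLeftMinWithin CriticalCurveRegular
  exact ⟨fun h => h.1, fun h => ⟨h, fun t ht _ => (Set.notMem_empty t ht).elim⟩⟩

/-- The rung contains the floor. -/
@[aesop safe forward] theorem criticalCurveRegular_of_isoLeftMin : IsoLeftMin → CriticalCurveRegular := by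
  unfold IsoLeftMin CurveLeftMinWithin CriticalCurveRegular
  exact fun h => h.1

/-- Sanity: the rung hands back the `T = ∅` member. -/
theorem floor_of_rung : IsoLeftMin → CurveLeftMinWithin ∅ :=
  curveLeftMinWithin_mono (Set.empty_subset _)

/-! ## The ON-PATH lemma (F4): `S → Rung` -/

/-- **ON-PATH LEMMA.** `PercolationContinuityZ3` implies the rung: the floor conjunct is the seed; by continuity
of `p_c` at `p₃` (the FLOOR) and `p_c(t) ≤ t` for `t > p₃` (the diagonal is isotropic bond percolation,
`ModelFacts` (9), `θ_{ℤ³} > 0` above `p_c(ℤ³)`), `p_c(p₃) ≤ p₃`; hence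
`J(p₃) = θ(p_c(p₃), p₃) ≤ θ(p₃,p₃) = θ_{ℤ³}(p_c(ℤ³)) = 0` under the statement, and `0 ≤ J(s)`. -/
@[aesop safe forward] theorem isoLeftMin_of_percolationContinuityZ3
    (hS : _root_.PercolationContinuityZ3) : IsoLeftMin := by
  have hCC := Summit.CriticalPhenomena.PercolationContinuityZ3.Cruxes.CriticalCurveRegular.Locmod.CriticalCurveRegular_proof
  obtain ⟨-, -, -, -, -, -, -, -, h9, -⟩ :=
    Summit.CriticalPhenomena.PercolationContinuityZ3.Theorems.ModelFacts.modelFacts_proof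
  have h3b := Literature.Probability.Percolation.Grimmett1999_criticalProb_pos_lt_one_holds 3 (by norm_num)
  delta IsoLeftMin CurveLeftMinWithin
  intro μ vert cfg θ pc
  refine ⟨hCC, ?_⟩
  obtain ⟨hcc1, -⟩ := hCC
  intro t₀ ht₀ _
  rw [Set.mem_singleton_iff] at ht₀
  subst ht₀
  -- (a) above the isotropic level the curve lies on or left of the diagonal: `pc t ≤ t` for `p₃ < t < 1`
  have hle : ∀ t : ℝ, Literature.Probability.Percolation.criticalProb (Literature.Probability.LatticeModels.zdGraph 3) (0 : Literature.Probability.LatticeModels.Site 3) < t → t < 1 → pc t ≤ t := by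
    intro t h3t ht1
    have ht0 : 0 ≤ t := h3b.1.le.trans h3t.le
    have hpos : 0 < θ t t := by
      have e : θ t t = Literature.Probability.Percolation.theta (Literature.Probability.LatticeModels.zdGraph 3) 0 ⟨t, ht0, ht1.le⟩ :=
        h9 ⟨t, ht0, ht1.le⟩
      rw [e]
      exact Literature.Probability.Percolation.theta_pos_of_criticalProb_lt_holds _ _ _ h3t
    show sInf ({p : ℝ | 0 ≤ p ∧ p ≤ 1 ∧ 0 < θ p t} ∪ {1}) ≤ t
    refine csInf_le ⟨0, fun x hx => ?_⟩ (Set.mem_union_left _ ⟨ht0, ht1.le, hpos⟩)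
    rcases hx with hx | hx
    · exact hx.1
    · rw [Set.mem_singleton_iff] at hx
      rw [hx]
      norm_num
  -- (b) continuity of the curve at `p₃` (the floor): `pc p₃ ≤ p₃`
  have hca : ContinuousAt pc (Literature.Probability.Percolation.criticalProb (Literature.Probability.LatticeModels.zdGraph 3) (0 : Literature.Probability.LatticeModels.Site 3)) := hcc1.continuousAt (Ioo_mem_nhds h3b.1 h3b.2)
  have hev : ∀ᶠ t in nhdsWithin (Literature.Probability.Percolation.criticalProb (Literature.Probability.LatticeModels.zdGraph 3) (0 : Literature.Probability.LatticeModels.Site 3)) (Set.Ioi (Literature.Probability.Percolation.criticalProb (Literature.Probability.LatticeModels.zdGraph 3) (0 : Literature.Probability.LatticeModels.Site 3))), pc t ≤ id t :=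
    Filter.mem_of_superset (Ioo_mem_nhdsGT h3b.2) fun t ht => hle t ht.1 ht.2
  have hpc3 : pc (Literature.Probability.Percolation.criticalProb (Literature.Probability.LatticeModels.zdGraph 3) (0 : Literature.Probability.LatticeModels.Site 3)) ≤ Literature.Probability.Percolation.criticalProb (Literature.Probability.LatticeModels.zdGraph 3) (0 : Literature.Probability.LatticeModels.Site 3) :=
    le_of_tendsto_of_tendsto (hca.tendsto.mono_left nhdsWithin_le_nhds)
      ((continuous_id.tendsto _).mono_left nhdsWithin_le_nhds) hev
  -- (c) `J(p₃) ≤ θ(p₃,p₃) = θ_{ℤ³}(p_c) = 0 ≤ J(s)`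
  have hmono : θ (pc (Literature.Probability.Percolation.criticalProb (Literature.Probability.LatticeModels.zdGraph 3) (0 : Literature.Probability.LatticeModels.Site 3))) (Literature.Probability.Percolation.criticalProb (Literature.Probability.LatticeModels.zdGraph 3) (0 : Literature.Probability.LatticeModels.Site 3)) ≤ θ (Literature.Probability.Percolation.criticalProb (Literature.Probability.LatticeModels.zdGraph 3) (0 : Literature.Probability.LatticeModels.Site 3)) (Literature.Probability.Percolation.criticalProb (Literature.Probability.LatticeModels.zdGraph 3) (0 : Literature.Probability.LatticeModels.Site 3)) :=
    Summit.CriticalPhenomena.PercolationContinuityZ3.Cruxes.CriticalCurveRegular.Locmod.theta_mono hpc3 le_rfl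
  have hdiag : θ (Literature.Probability.Percolation.criticalProb (Literature.Probability.LatticeModels.zdGraph 3) (0 : Literature.Probability.LatticeModels.Site 3)) (Literature.Probability.Percolation.criticalProb (Literature.Probability.LatticeModels.zdGraph 3) (0 : Literature.Probability.LatticeModels.Site 3)) = 0 := by
    have e := h9 (Literature.Probability.Percolation.criticalProbI 3)
    exact e.trans hS
  refine ⟨Literature.Probability.Percolation.criticalProb (Literature.Probability.LatticeModels.zdGraph 3) (0 : Literature.Probability.LatticeModels.Site 3) / 2, by linarith [h3b.1], by linarith [h3b.1], fun s _ => ?_⟩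
  have hnn : 0 ≤ θ (pc s) s := MeasureTheory.measureReal_nonneg
  exact (hmono.trans hdiag.le).trans hnn

/-- `S → Rung → floor`. -/
theorem rung_between :
    (_root_.PercolationContinuityZ3 → IsoLeftMin) ∧ (IsoLeftMin → CriticalCurveRegular) :=
  ⟨isoLeftMin_of_percolationContinuityZ3, criticalCurveRegular_of_isoLeftMin⟩

end Summit.CriticalPhenomena.PercolationContinuityZ3.Cruxes.SupercritExchangeUniformity.LeftMin.OnPath
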